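/-
Copyright (c) 2026 the pub-hodgecm-mathlib formalisation cell (harness21).  Prover seat hodgecm-mathlib-LH4-p06 (g0): unit U2H_HSide of the «(D-RAM) FOUR-FRAME» road,
TIER-2 brick «T∕P» (depth token + parity) of the row-(1) matching lemma behind `stub_U2H_hSideAnchorRows_unit0` (design `U2H-ED4-DRAFT-DESIGN.v1` §2).  2026-09-03.
-/
import Literature.NumberTheory.Automorphic.RamifiedPlaceAntiFixedUniformizer               -- ★ `valued_toPlace_uniformizer_of_ramified` (`|ι_w ϖ_v|_w = exp(−2)` at a ramified place)
import Summits.HodgeConjecture.HodgeConjecture.Theorems.F0P3cDyRamCayleySignFPartProd      -- ★ p855070: `valued_eq_one_of_mul_map_eq_one`; brings ★ #0a `IsRamifiedQuadraticDatum`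
import HarnessLib

/-!
# Crux `H413`, line LH4 «(D-RAM) FOUR-FRAME» road — unit U2H_HSide (ii-H), TIER 2, brick «T∕P»: THE DEPTH TOKEN OF ROW (1) FROM THE ELEMENT DATUM,
# `|(z − z a²)(z − z b²)|_w = |ι_w ϖ_v|_w^{(n₁+n₂)∕2}` with `n₁ + n₂` EVEN (every ramified non-split place, dyadic included)

Cell `hodgecm-mathlib` (D-0151), FLOOR 0, crux item H413 = `stmt-HodgeConjecture-24833`, route of record `HCCMUnconditional`; squad F0∕P3c∕LH4; tier-1 module
`Cruxes/H413/Lines/F0_P3c_DyRamFourFrame_U2H_HSide.lean`, export `stub_U2H_hSideAnchorRows_unit0` (seat LH4-p06 (g0)).  THEOREMS ONLY (no `def`, no instance, no notation, no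
`sorry`, no named fact, default heartbeats); lane `--supports stmt-HodgeConjecture-24833` (count-neutral).

WHAT THIS BRICK DOES.  Bricks «Δ1»∕«Δ2» (`F0P3cDyRamRowOneDeltaBaseValue`) take the depth token in ★ T5-u-ANY-PLACE's currency `|χ_g(z)_w|_w = |ι_w ϖ_v|_w^m`; (D-H) row (1)
carries instead the ELEMENT DATUM `IsElementDatum σ ϖ N₀ (a²) (b²) n₁ n₂ n₃` (`|b² − 1| = |ϖ|^{n₁}`, `|a² − 1| = |ϖ|^{n₂}`, `ϖ` a uniformiser of `E = L_w`) inside the PLACE DATUM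
`IsRamifiedQuadraticDatum σ ϖ d t_E` (σ-fixed non-zero elements have EVEN order).  Here: (P) `n₁ + n₂` is EVEN — `a² − 1 = a·(a − σa)` with `a − σa` SKEW, and two skews `s, s′`
have `|s·s′| = |sδ|·|s′δ|∕|δ²|` a ratio of fixed valuations, all of even order (datum clause 4; `δ` any non-zero skew) —, and (T) `|(z − z a²)(z − z b²)|_w = |ϖ|^{n₁+n₂} =
|ι_w ϖ_v|^{(n₁+n₂)∕2}` (`|z| = 1`, `|ι_w ϖ_v| = exp(−2)` ★ at a ramified place).  So «Δ2»'s `m` is `(n₁ + n₂)∕2` on the row's data, with no parity hypothesis left over.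

* §1 `exists_valued_mul_eq_exp_two_mul_of_skew` (two non-zero skews multiply to an element of even order, from the datum's clause 4), `sq_sub_one_eq_mul_sub_map` (`a·a − 1 = a·(a − σa)`).
* §2 HEAD **`valued_rootProduct_eq_toPlace_pow_half_of_datum`** (T) + (P): `2·((n₁+n₂)∕2) = n₁ + n₂` and the token identity.

HONEST LABEL.  Count-neutral; nothing printed is asserted; `HC_CM` is proved only modulo the 7 printed citations (2 remaining: hLiu418 = `stmt-HodgeConjecture-24832`, h413 =
`stmt-HodgeConjecture-24833`) until rung 0 closes.

## References
* [Rogawski1990] J. D. Rogawski, *Automorphic Representations of Unitary Groups in Three Variables*, Ann. of Math. Stud. 123 (1990): §4.9 p. 55 (`D_{G∕H} = |Π(1 − α)|^{1∕2}`),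
  Lemma 4.9.3 (4.9.2) p. 56.
* [Serre1979] J.-P. Serre, *Local Fields*, GTM 67 (1979): Ch. IV §2 Prop. 5, Ch. III §6 (orders of fixed ∕ anti-fixed elements at a ramified place).
* [LabesseLanglands1979] J.-P. Labesse, R. P. Langlands, *L-indistinguishability for SL(2)*, Canad. J. Math. 31 (1979): §2 (2.2) (parity of the depth).
-/

set_option autoImplicit false

noncomputable section

namespace Summit.HodgeConjecture.HodgeConjecture.Cruxes.H413.F0P3cDyRamRowOneDepthToken

open NumberField IsDedekindDomain
open Literature.NumberTheory.Automorphic Literature.NumberTheory.Automorphic.UnitaryGroup Literature.NumberTheory.GaloisRepresentations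
open Literature.NumberTheory.Automorphic.UnitaryThreeFourFrame
open Summit.HodgeConjecture.HodgeConjecture.Cruxes.H413.F0P3cDyRamCayleySignFPartProd
open scoped Valued WithZero

/-! ## §1 Generic valued-field facts under the place datum -/

section Generic

variable {K : Type} [Field K] [Valued K ℤᵐ⁰] {σ : K →+* K} {ϖ : K} {d t : ℕ}

/-- **Two non-zero SKEW elements multiply to an element of EVEN order** under the place datum (clause 4: σ-fixed non-zero elements have even order): with any non-zero
skew `δ`, `s·s′ = (sδ)(s′δ)∕δ²` and `sδ`, `s′δ`, `δ²` are fixed. [cite: Serre1979, Ch. IV §2 Prop. 5] -/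
theorem exists_valued_mul_eq_exp_two_mul_of_skew (hD : IsRamifiedQuadraticDatum σ ϖ d t) {δ s s' : K}
    (hδ : σ δ = -δ) (hδ0 : δ ≠ 0) (hs : σ s = -s) (hs0 : s ≠ 0) (hs' : σ s' = -s') (hs'0 : s' ≠ 0) :
    ∃ N : ℤ, Valued.v (s * s') = WithZero.exp (2 * N) := by
  obtain ⟨-, -, -, hfix, -, -, -⟩ := hD
  obtain ⟨n₁, h₁⟩ := hfix (s * δ) (by rw [map_mul, hs, hδ]; ring) (mul_ne_zero hs0 hδ0)
  obtain ⟨n₂, h₂⟩ := hfix (s' * δ) (by rw [map_mul, hs', hδ]; ring) (mul_ne_zero hs'0 hδ0)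
  obtain ⟨n₃, h₃⟩ := hfix (δ * δ) (by rw [map_mul, hδ]; ring) (mul_ne_zero hδ0 hδ0)
  refine ⟨n₁ + n₂ - n₃, ?_⟩
  have hvδ : Valued.v (δ * δ) ≠ 0 := (Valuation.ne_zero_iff _).2 (mul_ne_zero hδ0 hδ0)
  have key : Valued.v (s * s') * Valued.v (δ * δ) = Valued.v (s * δ) * Valued.v (s' * δ) := by
    rw [← map_mul, ← map_mul]; ring_nf
  have h : Valued.v (s * s') = Valued.v (s * δ) * Valued.v (s' * δ) / Valued.v (δ * δ) := by
    rw [eq_div_iff hvδ, key]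
  rw [h, h₁, h₂, h₃, ← WithZero.exp_add, ← WithZero.exp_sub]
  congr 1; ring

omit [Valued K ℤᵐ⁰] in
/-- `a·a − 1 = a·(a − σ a)` for norm-one `a` (`σ a = a⁻¹`), and `a − σa` is skew. [cite: LabesseLanglands1979, §2 (2.2)] -/
theorem sq_sub_one_eq_mul_sub_map {a : K} (ha : a * σ a = 1) : a * a - 1 = a * (a - σ a) := by
  linear_combination ha

omit [Valued K ℤᵐ⁰] in
/-- `σ(a − σa) = −(a − σa)` when `σ` is an involution on `a`. [folklore] -/
theorem map_sub_map_eq_neg {a : K} (hσσ : σ (σ a) = a) : σ (a - σ a) = -(a - σ a) := by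
  rw [map_sub, hσσ]; ring

end Generic

/-! ## §2 HEAD: the depth token of row (1) from the element datum, with the parity -/

section Head

variable (L : Type) [Field L] [NumberField L] [IsCMField L] (v : HeightOneSpectrum (𝓞 ↥(maximalRealSubfield L)))
  (w : PlacesOver L v) (hw : IsCMField.complexConj L • w.1 = w.1)

include hw in
/-- **HEAD «T∕P» — THE DEPTH TOKEN FROM THE ELEMENT DATUM, PARITY INCLUDED.**  At a ramified non-split place `w ∣ v` (`e ≠ 1`) with place datum `IsRamifiedQuadraticDatum σ_w ϖ d t_E`
and a non-zero skew `δ`: for norm-one `a, b, z` with `|a·a − 1| = |ϖ|^{n₂}`, `|b·b − 1| = |ϖ|^{n₁}` (the `IsElementDatum` clauses of (D-H) row (1) at `(α, β) = (a², b²)`):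
`2·((n₁ + n₂)∕2) = n₁ + n₂` AND `|(z − z·a·a)(z − z·b·b)|_w = |ι_w ϖ_v|_w^{(n₁+n₂)∕2}` — the `m` of bricks «Δ1»∕«Δ2» is `(n₁ + n₂)∕2`.
[cite: Rogawski1990, §4.9 p. 55; Lemma 4.9.3 (4.9.2) p. 56] [cite: Serre1979, Ch. IV §2 Prop. 5; Ch. III §6] [cite: LabesseLanglands1979, §2 (2.2)] -/
theorem valued_rootProduct_eq_toPlace_pow_half_of_datum (he : v.asIdeal.ramificationIdx' w.1.asIdeal ≠ 1)
    {ϖ δ a b z : w.1.adicCompletion L} {d tE n₁ n₂ : ℕ}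
    (hD : IsRamifiedQuadraticDatum (galAdicCompletionMap (L := L) (IsCMField.complexConj L) hw) ϖ d tE)
    (hδ : galAdicCompletionMap (L := L) (IsCMField.complexConj L) hw δ = -δ) (hδ0 : δ ≠ 0)
    (ha : a * galAdicCompletionMap (L := L) (IsCMField.complexConj L) hw a = 1) (hb : b * galAdicCompletionMap (L := L) (IsCMField.complexConj L) hw b = 1)
    (hz : z * galAdicCompletionMap (L := L) (IsCMField.complexConj L) hw z = 1)
    (hn₂ : Valued.v (a * a - 1) = Valued.v ϖ ^ n₂) (hn₁ : Valued.v (b * b - 1) = Valued.v ϖ ^ n₁) :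
    2 * ((n₁ + n₂) / 2) = n₁ + n₂ ∧
      Valued.v ((z - z * (a * a)) * (z - z * (b * b))) =
        Valued.v ((toPlace v w (HeckeCharacter.uniformizer ↥(maximalRealSubfield L) v : v.adicCompletion ↥(maximalRealSubfield L))) ^ ((n₁ + n₂) / 2)) := by
  set σ := galAdicCompletionMap (L := L) (IsCMField.complexConj L) hw with hσdef
  have hc1 : IsCMField.complexConj L ≠ 1 := IsCMField.complexConj_ne_one L
  have hσσ : ∀ x, σ (σ x) = x := fun x =>
    galAdicCompletionMap_galAdicCompletionMap_of_smul_eq (IsCMField.complexConj L) w hc1 hw x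
  have hϖ : Valued.v ϖ = WithZero.exp (-1 : ℤ) := hD.2.2.1
  have hϖ0 : Valued.v ϖ ≠ 0 := by rw [hϖ]; exact WithZero.coe_ne_zero
  have hva : Valued.v a = 1 := valued_eq_one_of_mul_map_eq_one L v w hw ha
  have hvb : Valued.v b = 1 := valued_eq_one_of_mul_map_eq_one L v w hw hb
  have hvz : Valued.v z = 1 := valued_eq_one_of_mul_map_eq_one L v w hw hz
  -- `a·a − 1 ≠ 0`, `b·b − 1 ≠ 0` (their valuations are powers of `|ϖ| ≠ 0`)
  have haa0 : a * a - 1 ≠ 0 := fun h => by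
    rw [h, map_zero] at hn₂; exact pow_ne_zero n₂ hϖ0 hn₂.symm
  have hbb0 : b * b - 1 ≠ 0 := fun h => by
    rw [h, map_zero] at hn₁; exact pow_ne_zero n₁ hϖ0 hn₁.symm
  -- (P) parity: `(a·a − 1)(b·b − 1) = a b · (a − σa)(b − σb)`, two skews
  have hsa : σ (a - σ a) = -(a - σ a) := map_sub_map_eq_neg (hσσ a)
  have hsb : σ (b - σ b) = -(b - σ b) := map_sub_map_eq_neg (hσσ b)
  have ha0 : a ≠ 0 := fun h => by rw [h, zero_mul] at ha; exact zero_ne_one ha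
  have hb0 : b ≠ 0 := fun h => by rw [h, zero_mul] at hb; exact zero_ne_one hb
  have hsa0 : a - σ a ≠ 0 := fun h => haa0 (by rw [sq_sub_one_eq_mul_sub_map ha, h, mul_zero])
  have hsb0 : b - σ b ≠ 0 := fun h => hbb0 (by rw [sq_sub_one_eq_mul_sub_map hb, h, mul_zero])
  obtain ⟨N, hN⟩ := exists_valued_mul_eq_exp_two_mul_of_skew hD hδ hδ0 hsa hsa0 hsb hsb0
  have hprod : Valued.v ((a * a - 1) * (b * b - 1)) = WithZero.exp (2 * N) := by
    rw [sq_sub_one_eq_mul_sub_map ha, sq_sub_one_eq_mul_sub_map hb, show a * (a - σ a) * (b * (b - σ b)) = (a * b) * ((a - σ a) * (b - σ b)) by ring,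
      map_mul, map_mul, hva, hvb, one_mul, one_mul, hN]
  have hsum : WithZero.exp (-((n₁ + n₂ : ℕ) : ℤ)) = WithZero.exp (2 * N) := by
    rw [← hprod, map_mul, hn₂, hn₁, hϖ, ← WithZero.exp_nsmul, ← WithZero.exp_nsmul, ← WithZero.exp_add]
    congr 1; push_cast; ring
  have hev : 2 * ((n₁ + n₂) / 2) = n₁ + n₂ := by
    have h := WithZero.exp_injective hsum
    omega
  refine ⟨hev, ?_⟩
  -- (T) the token
  have hk : (((n₁ + n₂) / 2 : ℕ) : ℤ) * 2 = ((n₁ + n₂ : ℕ) : ℤ) := by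
    exact_mod_cast (by omega : ((n₁ + n₂) / 2) * 2 = n₁ + n₂)
  have hfac : (z - z * (a * a)) * (z - z * (b * b)) = (z * z) * ((a * a - 1) * (b * b - 1)) := by ring
  rw [hfac, map_mul, map_mul, hvz, one_mul, one_mul, hprod, ← hsum, map_pow, (valued_toPlace_uniformizer_of_ramified L (IsCMField.complexConj L) hc1 w hw he).1,
    ← WithZero.exp_nsmul]
  congr 1
  rw [nsmul_eq_mul]
  linarith

end Head

end Summit.HodgeConjecture.HodgeConjecture.Cruxes.H413.F0P3cDyRamRowOneDepthToken

end
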